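import Summits.BirchSwinnertonDyer.BirchSwinnertonDyer.Theorems.ByReductionTypeAtTwoRankOneAtTwoOneDoorLawDefs
import Summits.BirchSwinnertonDyer.Rank1Residual.P2.HeegnerIndexAtTwo
import Summits.BirchSwinnertonDyer.Rank1Residual.P2.CountsAtTwoZhai16
import Summits.BirchSwinnertonDyer.Rank1Residual.F1Sign2.EggLemmaAtTwoProofs
import Literature.NumberTheory.EllipticCurves.Pal2012.QuadraticTwistPeriodProofs
import Literature.NumberTheory.QuadraticFields.ImaginaryResiduePiForm
import Literature.NumberTheory.EllipticCurves.GlobalMinimalModelProofs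
import Literature.NumberTheory.EllipticCurves.LFunctionSmulProofs
import Literature.NumberTheory.EllipticCurves.HeegnerPointsClassesProofs
import Literature.NumberTheory.EllipticCurves.HeegnerPointsProofs
import Literature.NumberTheory.EllipticCurves.HeegnerPointsRationalityProofs
import Literature.NumberTheory.EllipticCurves.LFunctionPrimeCoeff
import Literature.NumberTheory.DiophantineGeometry.Conductor
import HarnessLib

/-!
# Route ByReductionTypeAtTwo, crux `RankOneAtTwoBigImageOddLocal` (stmt-BirchSwinnertonDyer-23715), line `one_door_law`:
# THE GLUE `S_doorGlue` PROVED — registered stub `stub_doorGlue` of `Lines/one_door_law.lean` (v7.1, sha 3d401fb8aa11)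

Lead prover seat `bsd-line-fkl-p1` g6 (2026-08-28).  The line `one_door_law` (planner `bsd-f1-sign2-an` g10, AN-27) reads the
`2`-part of BSD for a rank-one curve of the W-42 (β) slice through the PROVED tree door
`P2.bsdp_two_iff_of_heegner_rankOne` («`BSD(E,2) ⟺ ord₂(8 I² t_W² / (n k² t_K² c² w² q_d |u| c_W)) = ord₂ #Ш(E)`») for ONE
`Sel₂`-trivialising door field `K`.  This file proves the line's glue stub BY NAME:

* `stub_doorGlue : S_doorGlue`, i.e. `S_pub → DoorIndexLawAtTwo → DoorTwistValueAtTwo → DoorSupplyAtTwo → S_manin → S_sliceMW`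
  (all six names are the tree's, `Theorems/ByReductionTypeAtTwoRankOneAtTwoOneDoorLawDefs.lean`, p610929).

The kernel bookkeeping (every item a tree theorem, no named fact beyond the binders of `S_pub`):
`E(ℚ)[2] = 0` from odd `#E(ℚ)_tors` (`noRationalTwoTorsion_of_odd_torsionOrder`); `E(K)[2] = 0` for the quadratic `K`
(`EggDoubling.eq_zero_of_two_smul_eq_zero_baseChange`, `EggLemmaAtTwoProofs.lean`), hence `#E(K)_tors` odd (Cauchy) and the halvability bit `k = 1`
(`P2.not_forall_halvable_of_odd_torsionOrder`); `rank E(K) = 1` (Gross–Zagier + Kolyvagin out of `S_pub`, as inside the door);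
`v₂ [E(K) : ℤP] = m` from the exact `2`-divisibility exponent `m` of the door law (`index_zmultiples_eq` on a generator of
`E(K)/tors`); `n = #π₀(E(ℝ)) = 1 + [Δ > 0]` (`P2.numRealComponents_eq_{one,two}_of_Δ_{neg,pos}`); `w_K = 2` since a door-admissible
`d_K ≡ 1 (8)`, `d_K < 0` has `d_K ≤ −7` (`Quadratic.torsionOrder_eq_two_of_discr_lt_neg_four`); `|u| = 1` for the minimal twist
model (Pal 2012 Prop. 2.5 / Cor. 2.6, tree theorem `u_eq_one_or_eq_neg_one_of_smul_quadraticTwist_of_squarefree`, `E` good at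
every `q ∣ d_K`); `t_W`, `c`, `c_W` odd by hypothesis; `v₂ q_d = v₂ c_W + t + 2s` from the value law.  The valuation is then
`3 + 2m − v₂ n − 2 − (t + 2s) = 2m + [Δ<0] − t − 2s`, which the door index law `2m + [Δ<0] = ord₂ #Ш(E)[2^∞] + t + 2s` turns into
`ord₂ #Ш(E)`.  BSD is not proved by any of this: the theorem is an implication whose antecedents `DoorIndexLawAtTwo` (conjecture),
`DoorTwistValueAtTwo`, `DoorSupplyAtTwo`, `S_manin` are OPEN statements of the tree and `S_pub` conjoins named published facts.
-/

set_option autoImplicit false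

noncomputable section

open scoped Classical

set_option linter.dupNamespace false

namespace Summit.BirchSwinnertonDyer.BirchSwinnertonDyer.Theorems.RankOneAtTwoOneDoor

open WeierstrassCurve NumberField IsDedekindDomain Rat.HeightOneSpectrum Literature.NumberTheory.EllipticCurves
  Literature.NumberTheory.EllipticCurves.ModularForms
  Literature.NumberTheory.EllipticCurves.KrizLi2019
  Summit.BirchSwinnertonDyer.Rank1Residual.F1Sign2
  Summit.BirchSwinnertonDyer.Rank1Residual.F1Sign2.TranspositionDoor
  Summit.BirchSwinnertonDyer.Rank1Residual

/-! ### §1 Elementary inputs: `E(ℚ)[2] = 0`, `E(K)[2] = 0`, `#E(K)_tors` odd, the index of the Heegner point -/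

/-- Odd `#E(ℚ)_tors` ⇒ the `2`-division cubic has no rational root (`NoRationalTwoTorsion`): a rational point of order `2`
would have even order dividing `#E(ℚ)_tors`. [folklore] -/
theorem noRationalTwoTorsion_of_odd_torsionOrder (W : WeierstrassCurve ℚ) [W.IsElliptic]
    (hodd : Odd W.torsionOrder) : NoRationalTwoTorsion W := by
  intro x hx
  obtain ⟨y, hxy, hy⟩ := hx
  have hns : W.toAffine.Nonsingular x y := WeierstrassCurve.Affine.equation_iff_nonsingular.1 hxy
  set P : W.toAffine.Point := WeierstrassCurve.Affine.Point.some x y hns with hPdef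
  have hP2 : 2 • P = 0 := by
    rw [two_nsmul, hPdef]
    exact WeierstrassCurve.Affine.Point.add_self_of_Y_eq (by
      rw [WeierstrassCurve.Affine.negY]; linear_combination hy)
  have hPne : P ≠ 0 := WeierstrassCurve.Affine.Point.some_ne_zero hns
  have hPtors : P ∈ AddCommGroup.torsion W.toAffine.Point := by
    rw [AddCommGroup.mem_torsion, isOfFinAddOrder_iff_nsmul_eq_zero]
    exact ⟨2, by norm_num, hP2⟩
  have hord : addOrderOf P = 2 := by
    haveI : Fact (Nat.Prime 2) := ⟨Nat.prime_two⟩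
    exact addOrderOf_eq_prime hP2 hPne
  have hdvd : 2 ∣ W.torsionOrder := by
    have h := (AddCommGroup.torsion W.toAffine.Point).addOrderOf_dvd_natCard hPtors
    rw [hord] at h
    unfold WeierstrassCurve.torsionOrder
    convert h
  exact (Nat.not_even_iff_odd.mpr hodd) (even_iff_two_dvd.mpr hdvd)

/-- `#E(K)_tors` is ODD over a quadratic field `K` when `E(ℚ)[2] = 0`: `E(K)[2] = 0`
(`eq_zero_of_two_smul_eq_zero_baseChange`: a cubic with no rational root has no root in a quadratic field) and Cauchy's
theorem in the finite group `E(K)_tors`. [folklore] -/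
theorem odd_torsionOrder_baseChange_of_noRationalTwoTorsion (W : WeierstrassCurve ℚ) [W.IsElliptic]
    (hT : NoRationalTwoTorsion W) (K : Type) [Field K] [NumberField K] (h2 : Module.finrank ℚ K = 2) :
    Odd (W.baseChange K).torsionOrder := by
  haveI hEK : (W.baseChange K).IsElliptic := isElliptic_baseChange' W K
  haveI := (W.baseChange K).finite_torsion_point
  rw [← Nat.not_even_iff_odd, even_iff_two_dvd]
  intro hdvd
  haveI : Fact (Nat.Prime 2) := ⟨Nat.prime_two⟩
  unfold WeierstrassCurve.torsionOrder at hdvd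
  obtain ⟨t, ht⟩ := exists_prime_addOrderOf_dvd_card' (G := AddCommGroup.torsion (W.baseChange K).toAffine.Point) 2 hdvd
  have h2t : 2 • t = 0 := by rw [← ht]; exact addOrderOf_nsmul_eq_zero t
  have ht0 : (t : (W.baseChange K).toAffine.Point) = 0 := by
    apply EggDoubling.eq_zero_of_two_smul_eq_zero_baseChange W hT h2
    have := congrArg (fun s : AddCommGroup.torsion (W.baseChange K).toAffine.Point =>
      (s : (W.baseChange K).toAffine.Point)) h2t
    simpa using this
  have ht0' : t = 0 := Subtype.ext ht0
  rw [ht0', addOrderOf_zero] at ht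
  exact absurd ht (by norm_num)

/-- **Index of a point with exact `2`-divisibility exponent.**  In `E(K)` of rank one with generator `g` of `E(K)/tors`
(every point `≡ n g`), a point `P ≡ 2^m • Q (mod tors)` with `Q` NOT twice a point modulo torsion has
`ord₂ [E(K) : ℤP] = m + ord₂ #E(K)_tors`.  (`Q ≡ b g` with `b` odd, `P ≡ 2^m b g`, `[E(K):ℤP] = 2^m |b| · #tors`.) [folklore] -/
theorem padicValNat_index_of_twoDivisibility {K : Type} [Field K] [NumberField K] (V : WeierstrassCurve K) [V.IsElliptic]
    {g : V.toAffine.Point} (hg : ¬ IsOfFinAddOrder g)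
    (hgen : ∀ y : V.toAffine.Point, ∃ n : ℤ, y - n • g ∈ AddCommGroup.torsion V.toAffine.Point)
    {P Q : V.toAffine.Point} {m : ℕ}
    (hPQ : P - (2 ^ m) • Q ∈ AddCommGroup.torsion V.toAffine.Point)
    (hQ : ¬ ∃ Q' : V.toAffine.Point, Q - 2 • Q' ∈ AddCommGroup.torsion V.toAffine.Point) :
    (AddSubgroup.zmultiples P).index ≠ 0 ∧
      padicValNat 2 (AddSubgroup.zmultiples P).index = m + padicValNat 2 V.torsionOrder := by
  haveI : Fact (Nat.Prime 2) := ⟨Nat.prime_two⟩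
  set T := AddCommGroup.torsion V.toAffine.Point with hT_def
  obtain ⟨b, hb⟩ := hgen Q
  -- `b` is odd: otherwise `Q ≡ 2 • (b/2) g`
  have hbodd : ¬ (2 : ℤ) ∣ b := by
    rintro ⟨b', rfl⟩
    apply hQ
    refine ⟨b' • g, ?_⟩
    have : (2 : ℕ) • (b' • g) = (2 * b') • g := by
      rw [two_nsmul, two_mul, add_smul]
    rw [this]; exact hb
  have hb0 : b ≠ 0 := by rintro rfl; exact hbodd (dvd_zero 2)
  -- `P ≡ (2^m b) g`
  have hP : P - ((2 : ℤ) ^ m * b) • g ∈ T := by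
    have h1 : (2 ^ m) • Q - ((2 : ℤ) ^ m * b) • g ∈ T := by
      have : (2 ^ m) • Q - ((2 : ℤ) ^ m * b) • g = ((2 : ℤ) ^ m) • (Q - b • g) := by
        rw [smul_sub, mul_smul, ← natCast_zsmul Q (2 ^ m)]; push_cast; rfl
      rw [this]; exact T.zsmul_mem hb _
    have : P - ((2 : ℤ) ^ m * b) • g = (P - (2 ^ m) • Q) + ((2 ^ m) • Q - ((2 : ℤ) ^ m * b) • g) := by abel
    rw [this]; exact T.add_mem hPQ h1
  have hcoef0 : (2 : ℤ) ^ m * b ≠ 0 := mul_ne_zero (pow_ne_zero _ two_ne_zero) hb0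
  have hidx : (AddSubgroup.zmultiples P).index = ((2 : ℤ) ^ m * b).natAbs * V.torsionOrder :=
    index_zmultiples_eq V hg hgen hcoef0 hP
  have htors : 0 < V.torsionOrder := V.torsionOrder_pos_holds
  have hnat : ((2 : ℤ) ^ m * b).natAbs = 2 ^ m * b.natAbs := by
    rw [Int.natAbs_mul, Int.natAbs_pow]; rfl
  refine ⟨?_, ?_⟩
  · rw [hidx, hnat]
    exact mul_ne_zero (mul_ne_zero (pow_ne_zero _ two_ne_zero) (Int.natAbs_ne_zero.mpr hb0)) htors.ne'
  · rw [hidx, hnat, padicValNat.mul (mul_ne_zero (pow_ne_zero _ two_ne_zero) (Int.natAbs_ne_zero.mpr hb0)) htors.ne',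
      padicValNat.mul (pow_ne_zero _ two_ne_zero) (Int.natAbs_ne_zero.mpr hb0), padicValNat.prime_pow,
      padicValNat.eq_zero_of_not_dvd (by
        intro h; exact hbodd (Int.ofNat_dvd_left.mpr h))]
    ring

/-! ### §2 The door field: `w_K = 2`, `|u| = 1` -/

/-- A door-admissible discriminant is `< −4` (it is negative and `≡ 1 (mod 8)`, so `≤ −7`). -/
theorem discr_lt_neg_four_of_doorAdmissible {W : WeierstrassCurve ℚ} [W.IsGloballyMinimal] {d : ℤ}
    (h : DoorAdmissible W d) : d < -4 := by
  obtain ⟨hneg, -, h8, -, -⟩ := h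
  omega

/-- `d ≡ 1 (mod 4)` for a door-admissible `d`. -/
theorem emod_four_of_doorAdmissible {W : WeierstrassCurve ℚ} [W.IsGloballyMinimal] {d : ℤ}
    (h : DoorAdmissible W d) : d % 4 = 1 := by
  obtain ⟨-, -, h8, -, -⟩ := h
  omega

/-- Pal's semistability hypothesis at the primes of a door-admissible `d`: `E` has GOOD reduction at every `q ∣ d`
(place / prime dictionary `hasGoodReductionAtPrime_iff_hasGoodReductionAt_ringOfIntegers`). -/
theorem good_or_mult_at_dvd_of_doorAdmissible (W : WeierstrassCurve ℚ) [W.IsElliptic] [W.IsGloballyMinimal] {d : ℤ}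
    (h : DoorAdmissible W d) :
    ∀ v : HeightOneSpectrum (𝓞 ℚ), ((primesEquiv v : ℕ) : ℤ) ∣ d →
      W.HasGoodReductionAt v ∨ W.HasMultiplicativeReductionAt v := by
  intro v hv
  left
  have hp : (primesEquiv v : ℕ).Prime := (primesEquiv v).2
  have hgood := h.2.2.2.1 _ hp hv ⟨hp⟩
  exact (hasGoodReductionAtPrime_iff_hasGoodReductionAt_ringOfIntegers v W).mp hgood

/-! ### §3 The glue -/

/-- **`stub_doorGlue` — the registered stub `S_doorGlue` of the line `one_door_law`, PROVED.**
`S_pub → DoorIndexLawAtTwo → DoorTwistValueAtTwo → DoorSupplyAtTwo → S_manin → S_sliceMW`: for `W` on the slice with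
Mordell–Weil rank `1`, take the door field `K` from the supply, an odd-constant datum `Dt` from `S_manin`, a Heegner datum and
the `K`-rational Heegner point `P` (tree theorems), the minimal twist model `Wd` and `q_d` from the value law, the exponent `m`
from the index law, and evaluate the door `P2.bsdp_two_iff_of_heegner_rankOne`:
`ord₂(8 I² t_W² / (n k² t_K² c² w² q_d |u| c_W)) = 3 + 2m − v₂ n − 2 − (t + 2s) = ord₂ #Ш(E)` by the law.
[cite: GrossZagier1986, Thm. I.6.3 and V.§2] [cite: Pal2012, Prop. 2.5 and Cor. 2.6] -/
theorem stub_doorGlue : S_doorGlue := by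
  intro hpub hIdx hVal hSup hMan W _ _ hCM hsurj hT hc hr hrk
  haveI : Fact (Nat.Prime 2) := ⟨Nat.prime_two⟩
  haveI hN : NeZero (W.conductorNorm ℤ) := ⟨(W.conductorNorm_pos_holds).ne'⟩
  set N : ℕ := W.conductorNorm ℤ with hN_def
  -- `E(ℚ)[2] = 0`
  have hT2 : NoRationalTwoTorsion W := noRationalTwoTorsion_of_odd_torsionOrder W hT
  -- the door field
  obtain ⟨K, _iF, _iN, hK, hadm, hSel, -, hHN⟩ := hSup W hT2 hrk
  have h2 : Module.finrank ℚ K = 2 := hK.1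
  haveI : IsTotallyComplex K := hK.2
  -- the odd-constant parametrisation, the Heegner datum, an embedding, the `K`-rational Heegner point
  obtain ⟨Dt, hcodd⟩ := hMan W hT2
  obtain ⟨H, -⟩ := nonempty_heegnerDatum_holds N K hK (exists_dvd_sq_sub_discr_holds N K hK hHN).choose_spec
  obtain ⟨ι⟩ : Nonempty (K →+* ℂ) := inferInstance
  obtain ⟨hGZ, hKo, hrat⟩ := hpub.1 N W K
  have hGZK : rank_eq_analyticRank_of_analyticRank_le_one := hpub.2.1
  have hmod : hasEntireLFunction_rat := hpub.2.2
  obtain ⟨P, hP⟩ := hrat hK hHN Dt H ι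
  -- the minimal twist model and the value law
  have hD0 : (NumberField.discr K : ℚ) ≠ 0 := by exact_mod_cast NumberField.discr_ne_zero K
  haveI hEt : (W.quadraticTwist (NumberField.discr K : ℚ)).IsElliptic := W.isElliptic_quadraticTwist hD0
  obtain ⟨Cd, hCd⟩ := hasGlobalMinimalModel_rat_holds (W.quadraticTwist (NumberField.discr K : ℚ))
  haveI : (Cd • W.quadraticTwist (NumberField.discr K : ℚ)).IsGloballyMinimal := hCd
  set Wd := Cd • W.quadraticTwist (NumberField.discr K : ℚ) with hWd_def
  have hWd : Cd • W.quadraticTwist (NumberField.discr K : ℚ) = Wd := rfl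
  obtain ⟨qd, hqd, hqd0, hvqd⟩ := hVal W hCM hT2 (NumberField.discr K) hadm hSel Wd Cd hWd
  -- `L(E^{(d_K)}, 1) ≠ 0`
  have hΩdC : (Wd.realPeriodRat : ℂ) ≠ 0 := by exact_mod_cast (Wd.realPeriodRat_pos_holds).ne'
  have hLt : (W.quadraticTwist (NumberField.discr K : ℚ)).entireLFunction 1 ≠ 0 := by
    have hLt' : (W.quadraticTwist (NumberField.discr K : ℚ)).entireLFunction = Wd.entireLFunction := by
      rw [← hWd, entireLFunction_smul]
    rw [hLt']
    intro h0
    apply hqd0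
    have : ((qd : ℚ) : ℂ) = 0 := by rw [← hqd, h0, zero_div]
    exact_mod_cast this
  -- the door index law at `(K, Dt, H, ι, P)`
  obtain ⟨hfin2, m, ⟨Q, hPQ, hQ⟩, hlaw⟩ :=
    hIdx W hCM hsurj hT hc hr K hK hadm hSel hLt Dt H ι P hP hcodd
  -- the door
  have hc0 : Dt.c ≠ 0 := by
    intro h0; apply hcodd; rw [h0]; exact dvd_zero _
  obtain ⟨k, hk12, hkiff, hdoor⟩ :=
    P2.bsdp_two_iff_of_heegner_rankOne W N K Dt H ι P hGZ hKo hGZK hmod hK hHN hP hc0 hr hLt Wd Cd hWd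
      qd hqd
  apply hdoor.mpr
  ------------------------------------------------------------------ rank `E(K) = 1`, `Ш(E)` finite (as inside the door)
  haveI hEK : (W.baseChange K).IsElliptic := isElliptic_baseChange' W K
  have hL0 : W.entireLFunction 1 = 0 := entireLFunction_one_eq_zero_of_analyticRank_eq_one hr
  obtain ⟨-, hderiv⟩ := leadingLCoeff_eq_deriv_of_analyticRank_eq_one hr
  have hprod := lDerivEK_eq_deriv_mul W K hmod hL0
  have hLK : LDerivEK W K ≠ 0 := by rw [hprod]; exact mul_ne_zero hderiv hLt
  have hPH : IsHeegnerPoint N W K P := ⟨Dt, H, ι, hP⟩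
  have hPinf : ¬ IsOfFinAddOrder P :=
    (lDerivEK_ne_zero_iff_not_isOfFinAddOrder W N K hGZ hK hHN hPH).mp hLK
  obtain ⟨hrkK, hShaK⟩ := hKo hK hHN hPH hPinf
  have hShaW : W.ShaFinite := Literature.NumberTheory.EllipticCurves.shaFinite_of_baseChange W K hShaK
  haveI hfinW : Finite W.sha := hShaW
  ------------------------------------------------------------------ `#E(K)_tors` odd, `k = 1`
  have htKodd : Odd (W.baseChange K).torsionOrder := odd_torsionOrder_baseChange_of_noRationalTwoTorsion W hT2 K h2
  have hk1 : k = 1 := by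
    rcases hk12 with h | h
    · exact h
    · exact absurd (hkiff.mp h) (P2.not_forall_halvable_of_odd_torsionOrder W K h2 hrkK hrk htKodd)
  ------------------------------------------------------------------ the index of `P`
  obtain ⟨gK, hgK, hgenK, -, -⟩ :=
    exists_generator_regulator_eq_of_mordellWeilRank_eq_one (W.baseChange K) hrkK
  have hQ' : ¬ ∃ Q' : (W.baseChange K).toAffine.Point,
      Q - 2 • Q' ∈ AddCommGroup.torsion (W.baseChange K).toAffine.Point := hQ
  obtain ⟨hI0, hvIdx⟩ := padicValNat_index_of_twoDivisibility (W.baseChange K) hgK hgenK hPQ hQ'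
  have hvtK : padicValNat 2 (W.baseChange K).torsionOrder = 0 :=
    padicValNat.eq_zero_of_not_dvd (fun h => (Nat.not_even_iff_odd.mpr htKodd) (even_iff_two_dvd.mpr h))
  ------------------------------------------------------------------ `w_K = 2`, `|u| = 1`
  have hw2 : Units.torsionOrder K = 2 :=
    Literature.NumberTheory.QuadraticFields.Quadratic.torsionOrder_eq_two_of_discr_lt_neg_four h2
      (discr_lt_neg_four_of_doorAdmissible hadm)
  have hu1 : |(Cd.u : ℚ)| = 1 := by
    rcases W.u_eq_one_or_eq_neg_one_of_smul_quadraticTwist_of_squarefree (emod_four_of_doorAdmissible hadm)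
        hadm.2.1 (good_or_mult_at_dvd_of_doorAdmissible W hadm) Wd Cd hWd with h | h <;> rw [h] <;> simp
  ------------------------------------------------------------------ oddness of `c_W`
  have hvcWn : padicValNat 2 W.tamagawaProduct = 0 :=
    padicValNat.eq_zero_of_not_dvd (fun h => (Nat.not_even_iff_odd.mpr hc) (even_iff_two_dvd.mpr h))
  ------------------------------------------------------------------ the valuation, factor by factor
  have hΔ0 : W.Δ ≠ 0 := W.isUnit_Δ.ne_zero
  have hI' : ((AddSubgroup.zmultiples P).index : ℚ) ≠ 0 := by exact_mod_cast hI0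
  have htW' : (W.torsionOrder : ℚ) ≠ 0 := by exact_mod_cast (W.torsionOrder_pos_holds).ne'
  have htK' : ((W.baseChange K).torsionOrder : ℚ) ≠ 0 := by
    exact_mod_cast ((W.baseChange K).torsionOrder_pos_holds).ne'
  have hcW' : (W.tamagawaProduct : ℚ) ≠ 0 := by exact_mod_cast (W.tamagawaProduct_pos_holds).ne'
  have hcM : (Dt.c : ℚ) ≠ 0 := by exact_mod_cast hc0
  have hw' : (Units.torsionOrder K : ℚ) ≠ 0 := by rw [hw2]; norm_num
  have hua : |(Cd.u : ℚ)| ≠ 0 := abs_ne_zero.mpr Cd.u.ne_zero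
  have hk' : ((k : ℕ) : ℚ) ≠ 0 := by rw [hk1]; norm_num
  have hn12 : (W.baseChange ℝ).numRealComponents = 1 ∨ (W.baseChange ℝ).numRealComponents = 2 :=
    numRealComponents_eq_one_or W
  have hn' : ((W.baseChange ℝ).numRealComponents : ℚ) ≠ 0 := by
    rcases hn12 with h | h <;> rw [h] <;> norm_num
  -- valuations of the single factors
  have h8 : padicValRat 2 (8 : ℚ) = 3 := by
    rw [show (8 : ℚ) = ((2 : ℕ) : ℚ) ^ 3 by norm_num, padicValRat.pow, padicValRat.self one_lt_two]; norm_num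
  have hvI : padicValRat 2 ((AddSubgroup.zmultiples P).index : ℚ) = (m : ℤ) := by
    rw [padicValRat.of_nat, hvIdx, hvtK]; push_cast; ring
  have hvtW : padicValRat 2 (W.torsionOrder : ℚ) = 0 := by
    rw [padicValRat.of_nat, padicValNat.eq_zero_of_not_dvd
      (fun h => (Nat.not_even_iff_odd.mpr hT) (even_iff_two_dvd.mpr h))]; rfl
  have hvtKq : padicValRat 2 ((W.baseChange K).torsionOrder : ℚ) = 0 := by
    rw [padicValRat.of_nat, hvtK]; rfl
  have hvcW : padicValRat 2 (W.tamagawaProduct : ℚ) = 0 := by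
    rw [padicValRat.of_nat, hvcWn]; rfl
  have hvc : padicValRat 2 (Dt.c : ℚ) = 0 := by
    rw [padicValRat.of_int, padicValInt.eq_zero_of_not_dvd hcodd]; rfl
  have hvw : padicValRat 2 (Units.torsionOrder K : ℚ) = 1 := by
    rw [hw2]; exact padicValRat.self one_lt_two
  have hvu : padicValRat 2 |(Cd.u : ℚ)| = 0 := by rw [hu1]; exact padicValRat.one
  have hvk : padicValRat 2 ((k : ℕ) : ℚ) = 0 := by
    rw [hk1, Nat.cast_one]; exact padicValRat.one
  have hvqd' : padicValRat 2 qd =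
      (transpCount W (NumberField.discr K) : ℤ) + 2 * (identCount W (NumberField.discr K) : ℤ) := by
    rw [hvqd, hvcWn]; push_cast; ring
  -- numerator and denominator
  have hA1 : (8 : ℚ) * ((AddSubgroup.zmultiples P).index : ℚ) ^ 2 ≠ 0 :=
    mul_ne_zero (by norm_num) (pow_ne_zero _ hI')
  have hA2 : (8 : ℚ) * ((AddSubgroup.zmultiples P).index : ℚ) ^ 2 * (W.torsionOrder : ℚ) ^ 2 ≠ 0 :=
    mul_ne_zero hA1 (pow_ne_zero _ htW')
  have hD1 : ((W.baseChange ℝ).numRealComponents : ℚ) * ((k : ℕ) : ℚ) ^ 2 ≠ 0 :=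
    mul_ne_zero hn' (pow_ne_zero _ hk')
  have hD2 : ((W.baseChange ℝ).numRealComponents : ℚ) * ((k : ℕ) : ℚ) ^ 2 *
      ((W.baseChange K).torsionOrder : ℚ) ^ 2 ≠ 0 := mul_ne_zero hD1 (pow_ne_zero _ htK')
  have hD3 : ((W.baseChange ℝ).numRealComponents : ℚ) * ((k : ℕ) : ℚ) ^ 2 *
      ((W.baseChange K).torsionOrder : ℚ) ^ 2 * (Dt.c : ℚ) ^ 2 ≠ 0 := mul_ne_zero hD2 (pow_ne_zero _ hcM)
  have hD4 : ((W.baseChange ℝ).numRealComponents : ℚ) * ((k : ℕ) : ℚ) ^ 2 *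
      ((W.baseChange K).torsionOrder : ℚ) ^ 2 * (Dt.c : ℚ) ^ 2 * (Units.torsionOrder K : ℚ) ^ 2 ≠ 0 :=
    mul_ne_zero hD3 (pow_ne_zero _ hw')
  have hD5 : ((W.baseChange ℝ).numRealComponents : ℚ) * ((k : ℕ) : ℚ) ^ 2 *
      ((W.baseChange K).torsionOrder : ℚ) ^ 2 * (Dt.c : ℚ) ^ 2 * (Units.torsionOrder K : ℚ) ^ 2 * qd ≠ 0 :=
    mul_ne_zero hD4 hqd0
  have hD6 : ((W.baseChange ℝ).numRealComponents : ℚ) * ((k : ℕ) : ℚ) ^ 2 *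
      ((W.baseChange K).torsionOrder : ℚ) ^ 2 * (Dt.c : ℚ) ^ 2 * (Units.torsionOrder K : ℚ) ^ 2 * qd *
      |(Cd.u : ℚ)| ≠ 0 := mul_ne_zero hD5 hua
  have hD7 : ((W.baseChange ℝ).numRealComponents : ℚ) * ((k : ℕ) : ℚ) ^ 2 *
      ((W.baseChange K).torsionOrder : ℚ) ^ 2 * (Dt.c : ℚ) ^ 2 * (Units.torsionOrder K : ℚ) ^ 2 * qd *
      |(Cd.u : ℚ)| * (W.tamagawaProduct : ℚ) ≠ 0 := mul_ne_zero hD6 hcW'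
  have hnum : padicValRat 2 ((8 : ℚ) * ((AddSubgroup.zmultiples P).index : ℚ) ^ 2 * (W.torsionOrder : ℚ) ^ 2) =
      3 + 2 * (m : ℤ) := by
    rw [padicValRat.mul hA1 (pow_ne_zero _ htW'), padicValRat.mul (by norm_num) (pow_ne_zero _ hI'),
      padicValRat.pow, padicValRat.pow, h8, hvI, hvtW]
    ring
  have hden : padicValRat 2 (((W.baseChange ℝ).numRealComponents : ℚ) * ((k : ℕ) : ℚ) ^ 2 *
      ((W.baseChange K).torsionOrder : ℚ) ^ 2 * (Dt.c : ℚ) ^ 2 * (Units.torsionOrder K : ℚ) ^ 2 * qd *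
      |(Cd.u : ℚ)| * (W.tamagawaProduct : ℚ)) =
      padicValRat 2 ((W.baseChange ℝ).numRealComponents : ℚ) + 2 +
        ((transpCount W (NumberField.discr K) : ℤ) + 2 * (identCount W (NumberField.discr K) : ℤ)) := by
    rw [padicValRat.mul hD6 hcW', padicValRat.mul hD5 hua, padicValRat.mul hD4 hqd0,
      padicValRat.mul hD3 (pow_ne_zero _ hw'), padicValRat.mul hD2 (pow_ne_zero _ hcM),
      padicValRat.mul hD1 (pow_ne_zero _ htK'), padicValRat.mul hn' (pow_ne_zero _ hk'),
      padicValRat.pow, padicValRat.pow, padicValRat.pow, padicValRat.pow,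
      hvk, hvtKq, hvc, hvw, hvqd', hvu, hvcW]
    ring
  have hprim : padicValNat 2 (Nat.card (AddCommGroup.primaryComponent W.sha 2)) =
      padicValNat 2 (Nat.card W.sha) := padicValNat_card_addPrimaryComponent 2
  rw [padicValRat.div hA2 hD7, hnum, hden, ← hprim]
  -- the law, by the sign of `Δ`
  rcases lt_or_gt_of_ne hΔ0 with hneg | hpos
  · rw [if_pos hneg] at hlaw
    rw [P2.numRealComponents_eq_one_of_Δ_neg hneg, Nat.cast_one, padicValRat.one]
    have hlawZ : (2 * m + 1 : ℤ) =
        (padicValNat 2 (Nat.card (AddCommGroup.primaryComponent W.sha 2)) : ℤ) +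
          transpCount W (NumberField.discr K) + 2 * identCount W (NumberField.discr K) := by
      exact_mod_cast hlaw
    omega
  · rw [if_neg (not_lt.mpr hpos.le), add_zero] at hlaw
    rw [P2.numRealComponents_eq_two_of_Δ_pos hpos, show ((2 : ℕ) : ℚ) = ((2 : ℕ) : ℚ) from rfl,
      padicValRat.self one_lt_two]
    have hlawZ : (2 * m : ℤ) =
        (padicValNat 2 (Nat.card (AddCommGroup.primaryComponent W.sha 2)) : ℤ) +
          transpCount W (NumberField.discr K) + 2 * identCount W (NumberField.discr K) := by
      exact_mod_cast hlaw
    omega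

/-- **The one-door reduction of the slice with the Mordell–Weil rank explicit**: `S_sliceMW` from the five inputs by name. -/
theorem sliceMW_of_oneDoor (hpub : S_pub) (hIdx : DoorIndexLawAtTwo) (hVal : DoorTwistValueAtTwo)
    (hSup : DoorSupplyAtTwo) (hMan : S_manin) : S_sliceMW :=
  stub_doorGlue hpub hIdx hVal hSup hMan

end Summit.BirchSwinnertonDyer.BirchSwinnertonDyer.Theorems.RankOneAtTwoOneDoor

end
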